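import Summits.CriticalPhenomena.PercolationContinuityZ3.Theorems.QuantitativeBGN.Negative.ArmLowerBound
import Literature.Probability.Percolation.HalfSpacePinnedPairs
import Literature.Probability.LatticeModels.IsoradialPercolation
import HarnessLib

/-!
# `QuantitativeBGN` (stmt-CriticalPhenomena-0913), line `longrange-wall-ghost-bootstrap` — definitions

The objects the line `longrange-wall-ghost-bootstrap` of the crux
`Summit.CriticalPhenomena.PercolationContinuityZ3.Theses.PercLowPointHalfSpace.QuantitativeBGN` posits
(skeleton `Cruxes/QuantitativeBGN/Lines/longrange-wall-ghost-bootstrap.lean`, card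
`Cruxes/QuantitativeBGN/Lines/longrange-wall-ghost-bootstrap.md`), stated in the tree's vocabulary so
that the line's stub files under `Theorems/` can import them (same role as
`PercLowPointHalfSpaceQuantitativeBGNFloorDefs.lean` for the floor line):

* `clusterH ω x` — the open cluster of `x` inside the half-space `H = {x | 0 ≤ x₀}`, using EVERY open
  pair of `ω` as a step (so that under the augmented measure the long wall bonds are legal steps); at
  `x = 0` it is the Literature's `halfSpaceCluster ω` (`clusterH_zero`, `rfl`);
* `footAt ω x ∈ ℕ∞` — its wall footprint `|C_H(x) ∩ {x₀ = 0}|`; at `x = 0` the Literature's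
  `halfSpaceFootprint ω` (`footAt_zero`, `rfl`); `footGe x n` the increasing event `{n ≤ footAt ω x}`;
* the AUXILIARY MODEL `augWall p λ α = prodBernoulli (augProb p λ α)` on the crux's own sample space
  `BondConfig (Site 3)`: bulk density `p` on the nearest-neighbour edges of `ℤ³`, probability
  `1 − exp(−λ ‖u−v‖^{−(2+α)})` on every unordered pair of distinct non-adjacent WALL vertices
  (`u₀ = v₀ = 0`, the set `wallPairs`), `0` elsewhere (`augWeight`, clamped into `[0,1]` by `augProb`); `wallBondProb p λ α x`
  the probability of the wall bond `{0, x}`, `WallIdx` the index type of the long wall bonds at `0`;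
* `wallTwoArm x n` — the wall two-arm event `S'_{x,n}` of the two-ghost inequality: `0` and `x` in
  DISTINCT `H`-clusters, both of footprint `≥ n`, `C_H(0)` finite.

The crux's own event `armH r` and the readback `quantitativeBGN_iff` are those of the landed Negative
lane (`Theorems/QuantitativeBGN/Negative/ArmLowerBound.lean`), imported, not re-declared. Plus the
one-line facts every user needs (value lemmas for `augWeight`/`augProb`, `0 ≤ augWeight ≤ 1` for
`λ ≥ 0`, agreement with `p` on lattice edges). Nothing here asserts anything about the crux; the
statements of the line (K1 wall two-ghost, K2_T stable wall, bootstrap, transfer, K3 thin-foot-tall)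
are the registered stubs of the skeleton and live in their own
`Theorems/PercLowPointHalfSpaceQuantitativeBGNWall*.lean` files.
-/

noncomputable section

open MeasureTheory Literature.Probability.Percolation Literature.Probability.LatticeModels
open scoped Classical ENNReal

namespace Summit.CriticalPhenomena.PercolationContinuityZ3.Theorems.WallGhost

/-! ## Half-space clusters read with every open pair as a step, and their wall footprints -/

/-- `clusterH ω x`: the vertices joined to `x` by an open path of `ω` inside `H = {x | 0 ≤ x₀}`, ALL
open pairs of `ω` being steps (`openConnIn` on the complete graph induced on `H`). Under the lattice
measures only lattice edges are open a.s.; under the augmented measure `augWall` the long wall bonds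
are genuine steps. [folklore] -/
def clusterH (ω : BondConfig (Site 3)) (x : Site 3) : Set (Site 3) :=
  {v | ω ∈ openConnIn {y : Site 3 | 0 ≤ y 0} x v}

/-- The wall footprint `F_x(ω) = |C_H(x) ∩ {x₀ = 0}| ∈ ℕ∞`. [folklore] -/
def footAt (ω : BondConfig (Site 3)) (x : Site 3) : ℕ∞ := (clusterH ω x ∩ {v | v 0 = 0}).encard

/-- The increasing event `{n ≤ F_x}`. [folklore] -/
def footGe (x : Site 3) (n : ℕ) : Set (BondConfig (Site 3)) := {ω | (n : ℕ∞) ≤ footAt ω x}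

/-- Unfolding of `clusterH`. [folklore] -/
theorem mem_clusterH {ω : BondConfig (Site 3)} {x v : Site 3} :
    v ∈ clusterH ω x ↔ ω ∈ openConnIn {y : Site 3 | 0 ≤ y 0} x v := Iff.rfl

/-- Unfolding of `footGe`. [folklore] -/
theorem mem_footGe {x : Site 3} {n : ℕ} {ω : BondConfig (Site 3)} :
    ω ∈ footGe x n ↔ (n : ℕ∞) ≤ footAt ω x := Iff.rfl

/-- **Readback**: at the origin `clusterH` is the Literature's half-space cluster `U(ω)`. [folklore] -/
theorem clusterH_zero (ω : BondConfig (Site 3)) : clusterH ω 0 = halfSpaceCluster ω := rfl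

/-- **Readback**: at the origin `footAt` is the Literature's `halfSpaceFootprint`. [folklore] -/
theorem footAt_zero (ω : BondConfig (Site 3)) : footAt ω 0 = halfSpaceFootprint ω := rfl

/-- **Readback**: the footprint events at the origin are the tail events of the Literature's
`halfSpaceFootprint` — the quantity `|U ∩ ∂H|` normalising the route's low-point identity. [folklore] -/
theorem footGe_zero_eq : ∀ n : ℕ, footGe 0 n = {ω : BondConfig (Site 3) | (n : ℕ∞) ≤ halfSpaceFootprint ω} :=
  fun _ => rfl

/-- `clusterH` is monotone in the configuration. [folklore] -/
theorem clusterH_mono {ω ω' : BondConfig (Site 3)} (h : ω ⊆ ω') (x : Site 3) :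
    clusterH ω x ⊆ clusterH ω' x :=
  fun v hv => isUpperSet_openConnIn _ x v h hv

/-- `footGe x n` is increasing. [folklore] -/
theorem isUpperSet_footGe (x : Site 3) (n : ℕ) : IsUpperSet (footGe x n) := by
  intro ω ω' hle hω
  exact le_trans hω (Set.encard_le_encard (Set.inter_subset_inter_left _ (clusterH_mono hle x)))

/-! ## The auxiliary model: bulk percolation plus long-range wall bonds -/

/-- Sup-norm distance of the two endpoints of an unordered pair of sites. [folklore] -/
def pairDist : Sym2 (Site 3) → ℝ := Sym2.lift ⟨fun u v => ‖u - v‖, fun u v => norm_sub_rev u v⟩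

/-- `pairDist` on a concrete pair. [folklore] -/
@[simp] theorem pairDist_mk (u v : Site 3) : pairDist s(u, v) = ‖u - v‖ := rfl

/-- The WALL pairs: unordered pairs of DISTINCT sites both on `∂H = {x₀ = 0}`. [folklore] -/
def wallPairs : Set (Sym2 (Site 3)) := {e | (∀ u ∈ e, u 0 = 0) ∧ ¬ e.IsDiag}

/-- Membership of a concrete pair in `wallPairs`. [folklore] -/
theorem mk_mem_wallPairs {u v : Site 3} : s(u, v) ∈ wallPairs ↔ u 0 = 0 ∧ v 0 = 0 ∧ u ≠ v := by
  simp [wallPairs, and_assoc]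

/-- Edge weights of the AUGMENTED model: bulk density `p` on nearest-neighbour lattice edges, the
long-range weight `1 - exp(-λ ‖u-v‖^{-(2+α)})` on non-adjacent wall pairs, `0` elsewhere. [folklore] -/
def augWeight (p : unitInterval) (lam α : ℝ) (e : Sym2 (Site 3)) : ℝ :=
  if e ∈ (zdGraph 3).edgeSet then (p : ℝ)
  else if e ∈ wallPairs then 1 - Real.exp (-(lam * pairDist e ^ (-(2 + α))))
  else 0

/-- The same weights clamped into `[0,1]` (a no-op for `λ ≥ 0`, `coe_augProb`). [folklore] -/
def augProb (p : unitInterval) (lam α : ℝ) (e : Sym2 (Site 3)) : unitInterval :=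
  Set.projIcc (0 : ℝ) 1 zero_le_one (augWeight p lam α e)

/-- **The auxiliary model**: independent bonds with probabilities `augProb p λ α` — bulk bond
percolation on `ℤ³` at density `p` plus long-range wall bonds; same sample space as the crux's
measure `bondPercolation (zdGraph 3) p`. [folklore] -/
def augWall (p : unitInterval) (lam α : ℝ) : Measure (BondConfig (Site 3)) :=
  prodBernoulli (augProb p lam α)

/-- `augWall p λ α` is a probability measure (a `prodBernoulli` measure). [folklore] -/
instance instIsProbabilityMeasureAugWall (p : unitInterval) (lam α : ℝ) :
    IsProbabilityMeasure (augWall p lam α) := by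
  unfold augWall; infer_instance

/-- The probability of the wall bond `{0, x}` in the augmented model. [folklore] -/
def wallBondProb (p : unitInterval) (lam α : ℝ) (x : Site 3) : ℝ :=
  (augProb p lam α s((0 : Site 3), x) : ℝ)

/-- Indices of the long wall bonds at `0`: wall points other than `0` and its lattice neighbours.
[folklore] -/
abbrev WallIdx : Type := {x : Site 3 // x 0 = 0 ∧ x ≠ 0 ∧ ¬ (zdGraph 3).Adj 0 x}

/-- The wall two-arm event `S'_{x,n}` of the two-ghost inequality: `0` and the wall point `x` lie in
DISTINCT `H`-clusters, both with wall footprint `≥ n`, and `C_H(0)` is finite. [folklore] -/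
def wallTwoArm (x : Site 3) (n : ℕ) : Set (BondConfig (Site 3)) :=
  {ω | ω ∉ openConnIn {y : Site 3 | 0 ≤ y 0} 0 x ∧ (n : ℕ∞) ≤ footAt ω 0 ∧ (n : ℕ∞) ≤ footAt ω x ∧
    (clusterH ω 0).Finite}

/-! ### Value lemmas -/

/-- On a lattice edge the augmented weight is the bulk density. [folklore] -/
theorem augWeight_of_mem_edgeSet (p : unitInterval) (lam α : ℝ) {e : Sym2 (Site 3)}
    (he : e ∈ (zdGraph 3).edgeSet) : augWeight p lam α e = p := by
  simp [augWeight, he]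

/-- On a non-adjacent wall pair the augmented weight is the long-range weight. [folklore] -/
theorem augWeight_of_mem_wallPairs (p : unitInterval) (lam α : ℝ) {e : Sym2 (Site 3)}
    (he : e ∉ (zdGraph 3).edgeSet) (hw : e ∈ wallPairs) :
    augWeight p lam α e = 1 - Real.exp (-(lam * pairDist e ^ (-(2 + α)))) := by
  simp [augWeight, he, hw]

/-- Elsewhere the augmented weight vanishes. [folklore] -/
theorem augWeight_of_not (p : unitInterval) (lam α : ℝ) {e : Sym2 (Site 3)}
    (he : e ∉ (zdGraph 3).edgeSet) (hw : e ∉ wallPairs) : augWeight p lam α e = 0 := by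
  simp [augWeight, he, hw]

/-- For `λ ≥ 0` the augmented weights are `≥ 0`. [folklore] -/
theorem augWeight_nonneg (p : unitInterval) {lam : ℝ} (hlam : 0 ≤ lam) (α : ℝ) (e : Sym2 (Site 3)) :
    0 ≤ augWeight p lam α e := by
  unfold augWeight
  split_ifs with h1 h2
  · exact p.2.1
  · have : Real.exp (-(lam * pairDist e ^ (-(2 + α)))) ≤ 1 := by
      rw [Real.exp_le_one_iff, neg_nonpos]
      exact mul_nonneg hlam (Real.rpow_nonneg (by
        induction e using Sym2.ind with
        | h u v => rw [pairDist_mk]; exact norm_nonneg _) _)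
    linarith
  · exact le_rfl

/-- The augmented weights are `≤ 1`. [folklore] -/
theorem augWeight_le_one (p : unitInterval) (lam α : ℝ) (e : Sym2 (Site 3)) :
    augWeight p lam α e ≤ 1 := by
  unfold augWeight
  split_ifs with h1 h2
  · exact p.2.2
  · linarith [Real.exp_pos (-(lam * pairDist e ^ (-(2 + α))))]
  · exact zero_le_one

/-- For `λ ≥ 0` the clamp is a no-op: `(augProb p λ α e : ℝ) = augWeight p λ α e`. [folklore] -/
theorem coe_augProb (p : unitInterval) {lam : ℝ} (hlam : 0 ≤ lam) (α : ℝ) (e : Sym2 (Site 3)) :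
    (augProb p lam α e : ℝ) = augWeight p lam α e := by
  rw [augProb, Set.projIcc_of_mem _ ⟨augWeight_nonneg p hlam α e, augWeight_le_one p lam α e⟩]

/-- On a lattice edge the augmented probability is the bulk density `p` (any `λ`). [folklore] -/
theorem augProb_of_mem_edgeSet (p : unitInterval) (lam α : ℝ) {e : Sym2 (Site 3)}
    (he : e ∈ (zdGraph 3).edgeSet) : augProb p lam α e = p := by
  rw [augProb, augWeight_of_mem_edgeSet p lam α he, Set.projIcc_of_mem _ p.2]

/-- Off the lattice edges and the wall pairs the augmented probability is `0`. [folklore] -/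
theorem augProb_of_not (p : unitInterval) (lam α : ℝ) {e : Sym2 (Site 3)}
    (he : e ∉ (zdGraph 3).edgeSet) (hw : e ∉ wallPairs) : augProb p lam α e = 0 := by
  rw [augProb, augWeight_of_not p lam α he hw]
  ext; simp

/-- **Monotone comparison of the weights**: the indicator weights of `bondPercolation (zdGraph 3) p`
(`p` on lattice edges, `0` elsewhere) are pointwise below `augProb p λ α` when `λ ≥ 0` — adding wall
bonds only raises probabilities. [folklore] -/
theorem indicator_le_augProb (p : unitInterval) {lam : ℝ} (hlam : 0 ≤ lam) (α : ℝ) :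
    (fun e : Sym2 (Site 3) => if e ∈ (zdGraph 3).edgeSet then p else 0) ≤ augProb p lam α := by
  intro e
  dsimp only
  split_ifs with he
  · exact (augProb_of_mem_edgeSet p lam α he).ge
  · change ((0 : unitInterval) : ℝ) ≤ (augProb p lam α e : ℝ)
    rw [coe_augProb p hlam α e]
    exact augWeight_nonneg p hlam α e

/-- `0 ≤ wallBondProb ≤ 1`. [folklore] -/
theorem wallBondProb_mem (p : unitInterval) (lam α : ℝ) (x : Site 3) :
    wallBondProb p lam α x ∈ Set.Icc (0 : ℝ) 1 :=
  (augProb p lam α s((0 : Site 3), x)).2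

end Summit.CriticalPhenomena.PercolationContinuityZ3.Theorems.WallGhost

end
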